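import Summits.Ventures.CertifiedQuantumChemistry.Rows.SectorRows
import Literature.MathematicalPhysics.QuantumLattice.HubbardNNNHoppingWindowCertificate
import HarnessLib

/-!
# Ventures/CertifiedQuantumChemistry — Rows/NSector.lean: sector rows bound the `N`-electron ground energy

HONEST FRAMING (verbatim): certified bounds for a stated model Hamiltonian in a stated basis; not a
claim about the real molecule beyond that model.

The cell's certified quantity is the SECTOR ground energy `Model.energy F a b = E₀(H_F; N_α = a,
N_β = b)` (ruling K1). For the closed-shell rows actually filed (`a = b = n`, e.g. N₂/STO-6G
`(7,7)`, H₁₀ `(5,5)`, the TV-H rings `(L/2, L/2)`) this IS the ground energy of `H_F` in the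
`N = 2n`-electron sector — the number a full-CI code reports — because the spin-free molecular
Hamiltonian commutes with `Ŝ_±` (`Literature…molecularHamiltonian_commute_spinPlus/Minus`, HJO §2.3.4)
and conserves `(N_α, N_β)`, so every spin multiplet of the `2n`-electron sector has a representative at
`S_z = 0` (tree: `groundEnergy_eq_minEnergyOn_szSector_of_su2`, Lieb PRL 62 (1989), proof of Thm 1).
Consequently a `LowerRow F n n lo` / `UpperRow F n n hi` bounds `groundEnergy F.hamiltonian (2n)`.
(For `a ≠ b` only the trivial direction `groundEnergy (a+b) ≤ Model.energy a b` holds in general.)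
Typer aside T-05 (lead T03-DESIGN §7 / K6: not needed by any filed row; recorded for the K1 reading
of the rows).
-/

noncomputable section

namespace Summit.Ventures.CertifiedQuantumChemistry

open Matrix Finset
open Literature.MathematicalPhysics.QuantumLattice Literature.MathematicalPhysics.QuantumChemistry

variable {k : ℕ}

/-- `E_pq` conserves `(N_α, N_β)` (it is a sum of same-spin hoppings). [folklore] -/
private theorem preservesSectors_singletExcitation (p q : Fin k) :
    PreservesSectors (singletExcitation p q) :=
  PreservesSectors.sum fun σ _ => LiebThm1.preservesSectors_hopping p q σ

/-- `e_pqrs = E_pq E_rs − δ_qr E_ps` conserves `(N_α, N_β)`. [folklore] -/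
private theorem preservesSectors_twoElectronExcitation (p q r s : Fin k) :
    PreservesSectors (twoElectronExcitation p q r s) := by
  rw [twoElectronExcitation_eq_mul_sub, sub_eq_add_neg,
    ← neg_one_smul ℂ (if q = r then singletExcitation p s else (0 : Matrix _ _ ℂ))]
  exact ((preservesSectors_singletExcitation p q).mul (preservesSectors_singletExcitation r s)).add
    (PreservesSectors.smul ((preservesSectors_singletExcitation p s).ite _) _)

/-- The model Hamiltonian is block diagonal in the sectors `(N_α, N_β)`. -/
theorem Model.preservesSectors_hamiltonian (F : Model k) : PreservesSectors F.hamiltonian := by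
  unfold Model.hamiltonian molecularHamiltonian
  refine PreservesSectors.add (PreservesSectors.add ?_ ?_) ?_
  · exact PreservesSectors.sum fun p _ => PreservesSectors.sum fun q _ =>
      (preservesSectors_singletExcitation p q).smul _
  · exact PreservesSectors.smul (PreservesSectors.sum fun p _ => PreservesSectors.sum fun q _ =>
      PreservesSectors.sum fun r _ => PreservesSectors.sum fun s _ =>
        (preservesSectors_twoElectronExcitation p q r s).smul _) _
  · rw [← Matrix.diagonal_one, ← Matrix.diagonal_smul]
    exact PreservesSectors.diagonal _

/-- **Closed-shell sectors give the `N`-electron ground energy**: for a symmetric model and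
`n ≤ k`, `groundEnergy H_F (2n) = Model.energy F n n` (spin-rotation invariance of the spin-free
Hamiltonian, HJO §2.3.4, + Lieb's `S_z = 0` representative argument, tree
`groundEnergy_eq_minEnergyOn_szSector_of_su2`). -/
theorem Model.groundEnergy_eq_energy {F : Model k} (hF : F.IsSymmetric) {n : ℕ} (hn : n ≤ k) :
    groundEnergy F.hamiltonian (2 * n) = F.energy n n := by
  have h := groundEnergy_eq_minEnergyOn_szSector_of_su2 (F.hamiltonian_isHermitian hF)
    F.preservesSectors_hamiltonian (molecularHamiltonian_commute_spinPlus _ _ _)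
    (molecularHamiltonian_commute_spinMinus _ _ _) (n := n) (by rwa [Fintype.card_fin])
  rw [h, Model.energy, sectorGroundEnergy_def, ← two_mul, sub_self, zero_div]

/-- A closed-shell LOWER row bounds the `2n`-electron ground energy of the model from below. -/
theorem LowerRow.le_groundEnergy {F : Model k} (hF : F.IsSymmetric) {n : ℕ} {lo : ℚ}
    (h : LowerRow F n n lo) : ((lo : ℚ) : ℝ) ≤ groundEnergy F.hamiltonian (2 * n) := by
  rw [Model.groundEnergy_eq_energy hF h.range.1]
  exact h.le

/-- A closed-shell UPPER row bounds the `2n`-electron ground energy of the model from above. -/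
theorem UpperRow.groundEnergy_le {F : Model k} (hF : F.IsSymmetric) {n : ℕ} {hi : ℚ}
    (h : UpperRow F n n hi) : groundEnergy F.hamiltonian (2 * n) ≤ ((hi : ℚ) : ℝ) := by
  rw [Model.groundEnergy_eq_energy hF h.range.1]
  exact h.le

/-- A closed-shell bracket brackets the `2n`-electron ground energy of the model. -/
theorem Bracket.groundEnergy_mem {F : Model k} (hF : F.IsSymmetric) {n : ℕ} {lo hi : ℚ}
    (h : Bracket F n n lo hi) :
    ((lo : ℚ) : ℝ) ≤ groundEnergy F.hamiltonian (2 * n) ∧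
      groundEnergy F.hamiltonian (2 * n) ≤ ((hi : ℚ) : ℝ) :=
  ⟨h.1.le_groundEnergy hF, h.2.groundEnergy_le hF⟩

end Summit.Ventures.CertifiedQuantumChemistry

end
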